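import Summits.QuantumFields.GaugeBoot.BootstrapCertificateCompleteness
import Summits.QuantumFields.GaugeBoot.BootstrapUnitaryGroupCuts
import HarnessLib

/-!
# `SU(N)` and `U(N)` on the torus: SOS ⊕ loop-equation certificates are sound and complete, and prove every strict bound on a Wilson expectation (gauge-boot, L1/L4 supplement)

HONEST FRAMING (cell `pub-gaugeboot`, page 1 of every file): the venture produces certified bounds
on lattice expectations at stated coupling, gauge group, dimension and torus size; NOT a mass gap,
NOT a continuum limit, NOT a string tension; NOT Yang–Mills-summit-bearing (barriers
`FixedCouplingUltralocality`, `PerturbativeInvisibility`). Structural; it certifies no number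
(it says what the cell's certificates CAN prove, not what any of them proves).

## Content (`SU(N)` / `U(N)` fundamental on `(ℤ/L)^d`, every `d`, `L ≥ 1`, `N`, every real `β`)

The cell's certificates are dual solutions of the word-truncated bootstrap SDP: identities
`c • 1 - P = Σ_j v_j² + Σ_l λ_l (f_l' - β f_l S_l')` with `v_j`, `f_l` of word length `≤ n`
(`certCone … (wordTruncation … n)`, abbreviated `certConeSuN N β n` / `certConeUN N β n`).

* ★★ SOUNDNESS `levelValues_le_of_mem_certCone_suN`, `wilson_le_of_mem_certCone_suN` (and lower /
  `U(N)` twins): a level-`n` certificate for `P ≤ c` bounds every level-`n` feasible value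
  (`levelValuesSuN N β n P ⊆ (-∞, c]`) and in particular the Wilson expectation `∫ P dμ_β ≤ c`.
* ★★★ COMPLETENESS `forall_levelValues_le_iff_suN`, `exists_certificate_suN` (+ lower, `U(N)`):
  for `P` in the level-`n` certificate domain (combinations of words of length `≤ 2n` and rows)
  EVERY constant strictly above `sup levelValuesSuN N β n P` has a level-`n` certificate — the SDP
  upper bound IS the infimum of the certified bounds (`sSup_levelValues_eq_sInf_suN`, no duality
  gap), the extrema are attained and `levelValuesSuN N β n P` is a compact interval containing the
  Wilson value (`levelValues_eq_Icc_suN`).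
* ★★★ `exists_certificate_of_wilson_lt_suN` / `_uN`, `exists_certificates_of_wilson_mem_Ioo_suN`
  — COMPLETENESS FOR THE WILSON MEASURE: for every polynomial observable `P` and every
  `c > ∫ P dμ_β` there is a level `n` and an SOS ⊕ loop-equation certificate
  `c • 1 - P = σ + ρ` (by completeness at level `n` + convergence of the truncated bootstrap,
  `levelValues_subset_Icc_suN`). Every true strict polynomial inequality between Wilson-measure
  expectations on a finite torus is provable in this proof system; nothing is said about the
  level `n` needed.

References: Anderson–Kruczenski (2017), Kazakov–Zheng (2022, 2024), Li–Zhou arXiv:2404.17071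
(the SDPs); Josz–Henrion, Optim. Lett. 10 (2016) 3 and Laurent, IMA Vol. 149 (2009) Thm 6.1 (no gap
in Lasserre's hierarchy under an archimedean/ball constraint — here unitarity). Folklore.
-/

noncomputable section

open MeasureTheory Filter Topology NormedSpace
open Literature.MathematicalPhysics.QuantumFieldTheory (LatticeRep Edge GaugeConfig wilsonAction
  wilsonMeasure isProbabilityMeasure_wilsonMeasure)
open Literature.MathematicalPhysics.QuantumLattice

namespace Summit.QuantumFields.GaugeBoot

open OrderUnitDuality

/-! ## `SU(N)` -/

section SuN

variable {d L : ℕ} [NeZero L] (N : ℕ) (β : ℝ)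

/-- **The level-`n` certificate cone of the `SU(N)` torus bootstrap**: SOS of test functions of
word length `≤ n` plus combinations of level-`n` Schwinger–Dyson row elements along the
exponential shifts `e^{tX}`, `X ∈ 𝔰𝔲(N)`. [folklore] -/
abbrev certConeSuN (n : ℕ) :
    PointedCone ℝ C(GaugeConfig d L (Matrix.specialUnitaryGroup (Fin N) ℂ), ℝ) :=
  certCone (fundamentalLatticeRep N) (suExp N) (fun _ => wilsonAction (fundamentalRep (Fin N))) β
    (wordTruncation (ι := Edge d L) (fundamentalLatticeRep N) n)

/-- **The level-`n` certificate domain** (combinations of words of length `≤ 2n` and level-`n`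
rows): the objectives a level-`n` certificate can bound. [folklore] -/
abbrev certDomainSuN (n : ℕ) :
    Submodule ℝ C(GaugeConfig d L (Matrix.specialUnitaryGroup (Fin N) ℂ), ℝ) :=
  certDomain (fundamentalLatticeRep N) (suExp N) (fun _ => wilsonAction (fundamentalRep (Fin N))) β n

/-- The Wilson action has polynomial derivatives along the `𝔰𝔲(N)` shifts. -/
theorem wilsonAction_polyDeriv_suN (i : Edge d L) (a : SuGenerator N) :
    ∃ S' ∈ polyAlgebra (ι := Edge d L) (fundamentalLatticeRep N),
      ∀ U : GaugeConfig d L (Matrix.specialUnitaryGroup (Fin N) ℂ),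
        HasDerivAt (fun t => wilsonAction (fundamentalRep (Fin N))
          (Function.update U i (suExp N a t * U i))) (S' U) 0 :=
  exists_polyDeriv_of_mem_polyFunctions (fundamentalLatticeRep N) (S := fun _ => wilsonAction
    (fundamentalRep (Fin N))) (suExp_add N) (X := fun X : SuGenerator N =>
    (X : Matrix (Fin N) (Fin N) ℂ)) (rho_suExp N)
    (fun _ => wilsonAction_mem_polyFunctions (fundamentalLatticeRep N)) i a

/-- The Wilson functional is level-`n` feasible: the feasible set is non-empty. -/
theorem exists_feasible_suN (n : ℕ) :
    ∃ φ₀ : C(GaugeConfig d L (Matrix.specialUnitaryGroup (Fin N) ℂ), ℝ) →ₗ[ℝ] ℝ,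
      IsBootstrapFeasible (fundamentalLatticeRep N) (suExp N)
        (fun _ => wilsonAction (fundamentalRep (Fin N))) β
        (wordTruncation (ι := Edge d L) (fundamentalLatticeRep N) n) φ₀ := by
  haveI : IsProbabilityMeasure (wilsonMeasure (d := d) (L := L) (fundamentalRep (Fin N)) β) :=
    isProbabilityMeasure_wilsonMeasure (ρ := fundamentalRep (Fin N)) (continuous_fundamentalRep _) β
  exact ⟨_, isBootstrapFeasible_wilson_suN N β _ rfl (wordTruncation_subset_polyAlgebra _ n)⟩

/-- `levelValuesSuN` is the `feasibleValues` of the general theory. -/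
theorem levelValuesSuN_eq_feasibleValues (n : ℕ)
    (P : C(GaugeConfig d L (Matrix.specialUnitaryGroup (Fin N) ℂ), ℝ)) :
    levelValuesSuN (d := d) (L := L) N β n P =
      feasibleValues (fundamentalLatticeRep N) (suExp N)
        (fun _ => wilsonAction (fundamentalRep (Fin N))) β n P :=
  rfl

/-- Test functions of level `≤ 2n` are in the level-`n` certificate domain. -/
theorem mem_certDomainSuN_of_mem_wordTruncation {n m : ℕ} (hmn : m ≤ n + n)
    {P : C(GaugeConfig d L (Matrix.specialUnitaryGroup (Fin N) ℂ), ℝ)}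
    (hP : P ∈ wordTruncation (ι := Edge d L) (fundamentalLatticeRep N) m) :
    P ∈ certDomainSuN (d := d) (L := L) N β n :=
  mem_certDomain_of_mem_wordTruncation _ (wordTruncation_mono _ hmn hP)

/-! ### Soundness -/

/-- ★★ **Soundness**: a level-`n` certificate `c • 1 - P ∈ certConeSuN` bounds every level-`n`
feasible value of `P` by `c`. [folklore] -/
theorem levelValues_le_of_mem_certCone_suN {n : ℕ}
    {P : C(GaugeConfig d L (Matrix.specialUnitaryGroup (Fin N) ℂ), ℝ)} {c : ℝ}
    (hc : c • (1 : C(GaugeConfig d L (Matrix.specialUnitaryGroup (Fin N) ℂ), ℝ)) - P ∈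
      certConeSuN (d := d) (L := L) N β n) :
    ∀ t ∈ levelValuesSuN (d := d) (L := L) N β n P, t ≤ c := by
  rintro t ⟨φ, hφ, rfl⟩
  exact hφ.apply_le_of_mem_certCone _ hc

/-- ★★ **Soundness, lower bounds**: `P - c • 1 ∈ certConeSuN` bounds the feasible values below.
[folklore] -/
theorem le_levelValues_of_mem_certCone_suN {n : ℕ}
    {P : C(GaugeConfig d L (Matrix.specialUnitaryGroup (Fin N) ℂ), ℝ)} {c : ℝ}
    (hc : P - c • (1 : C(GaugeConfig d L (Matrix.specialUnitaryGroup (Fin N) ℂ), ℝ)) ∈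
      certConeSuN (d := d) (L := L) N β n) :
    ∀ t ∈ levelValuesSuN (d := d) (L := L) N β n P, c ≤ t := by
  rintro t ⟨φ, hφ, rfl⟩
  exact hφ.le_apply_of_mem_certCone _ hc

/-- ★★ **Soundness for the Wilson measure**: a level-`n` certificate for `P ≤ c` proves
`∫ P dμ_β ≤ c` (every `β`, `d`, `L`, `N`). [folklore] -/
theorem wilson_le_of_mem_certCone_suN {n : ℕ}
    {P : C(GaugeConfig d L (Matrix.specialUnitaryGroup (Fin N) ℂ), ℝ)} {c : ℝ}
    (hc : c • (1 : C(GaugeConfig d L (Matrix.specialUnitaryGroup (Fin N) ℂ), ℝ)) - P ∈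
      certConeSuN (d := d) (L := L) N β n) :
    ∫ U, P U ∂(wilsonMeasure (fundamentalRep (Fin N)) β) ≤ c :=
  levelValues_le_of_mem_certCone_suN N β hc _ (wilson_mem_levelValues_suN N β n P)

/-- ★★ **Soundness for the Wilson measure, lower bounds.** [folklore] -/
theorem le_wilson_of_mem_certCone_suN {n : ℕ}
    {P : C(GaugeConfig d L (Matrix.specialUnitaryGroup (Fin N) ℂ), ℝ)} {c : ℝ}
    (hc : P - c • (1 : C(GaugeConfig d L (Matrix.specialUnitaryGroup (Fin N) ℂ), ℝ)) ∈
      certConeSuN (d := d) (L := L) N β n) :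
    c ≤ ∫ U, P U ∂(wilsonMeasure (fundamentalRep (Fin N)) β) :=
  le_levelValues_of_mem_certCone_suN N β hc _ (wilson_mem_levelValues_suN N β n P)

/-! ### Completeness at a fixed level -/

/-- ★★★ **No duality gap for the `SU(N)` torus bootstrap**: for `P` in the level-`n` certificate
domain, every level-`n` feasible value of `P` is `≤ c` iff `(c + ε) • 1 - P` has a level-`n`
SOS ⊕ loop-equation certificate for every `ε > 0`. [folklore] -/
theorem forall_levelValues_le_iff_suN {n : ℕ}
    {P : C(GaugeConfig d L (Matrix.specialUnitaryGroup (Fin N) ℂ), ℝ)}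
    (hP : P ∈ certDomainSuN (d := d) (L := L) N β n) {c : ℝ} :
    (∀ t ∈ levelValuesSuN (d := d) (L := L) N β n P, t ≤ c) ↔
      ∀ ε : ℝ, 0 < ε → (c + ε) • (1 : C(GaugeConfig d L (Matrix.specialUnitaryGroup (Fin N) ℂ), ℝ))
        - P ∈ certConeSuN (d := d) (L := L) N β n := by
  rw [← forall_feasible_apply_le_iff (fundamentalLatticeRep N) (wilsonAction_polyDeriv_suN N)
    (exists_feasible_suN N β n) hP]
  exact ⟨fun h φ hφ => h _ ⟨φ, hφ, rfl⟩, fun h t ⟨φ, hφ, ht⟩ => ht ▸ h φ hφ⟩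

/-- ★★★ **Every constant strictly above the level-`n` SDP maximum has a level-`n` certificate**
`c' • 1 - P = σ + ρ`, `σ` a non-negative combination of squares of test functions of word length
`≤ n`, `ρ` a combination of level-`n` row elements. [folklore] -/
theorem exists_certificate_suN {n : ℕ}
    {P : C(GaugeConfig d L (Matrix.specialUnitaryGroup (Fin N) ℂ), ℝ)}
    (hP : P ∈ certDomainSuN (d := d) (L := L) N β n) {c c' : ℝ}
    (h : ∀ t ∈ levelValuesSuN (d := d) (L := L) N β n P, t ≤ c) (hc : c < c') :
    ∃ σ ∈ sosCone (wordTruncation (ι := Edge d L) (fundamentalLatticeRep N) n),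
      ∃ ρ ∈ rowSpace (fundamentalLatticeRep N) (suExp N) (fun _ => wilsonAction (fundamentalRep (Fin N)))
        β (wordTruncation (ι := Edge d L) (fundamentalLatticeRep N) n),
        σ + ρ = c' • (1 : C(GaugeConfig d L (Matrix.specialUnitaryGroup (Fin N) ℂ), ℝ)) - P :=
  exists_certificate_of_forall_apply_le (fundamentalLatticeRep N) (wilsonAction_polyDeriv_suN N)
    (exists_feasible_suN N β n) hP (fun φ hφ => h _ ⟨φ, hφ, rfl⟩) hc

/-- ★★★ **Lower bounds: every constant strictly below the level-`n` SDP minimum has a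
certificate** `P - c' • 1 = σ + ρ`. [folklore] -/
theorem exists_lower_certificate_suN {n : ℕ}
    {P : C(GaugeConfig d L (Matrix.specialUnitaryGroup (Fin N) ℂ), ℝ)}
    (hP : P ∈ certDomainSuN (d := d) (L := L) N β n) {c c' : ℝ}
    (h : ∀ t ∈ levelValuesSuN (d := d) (L := L) N β n P, c ≤ t) (hc : c' < c) :
    ∃ σ ∈ sosCone (wordTruncation (ι := Edge d L) (fundamentalLatticeRep N) n),
      ∃ ρ ∈ rowSpace (fundamentalLatticeRep N) (suExp N) (fun _ => wilsonAction (fundamentalRep (Fin N)))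
        β (wordTruncation (ι := Edge d L) (fundamentalLatticeRep N) n),
        σ + ρ = P - c' • (1 : C(GaugeConfig d L (Matrix.specialUnitaryGroup (Fin N) ℂ), ℝ)) :=
  exists_certificate_of_forall_le_apply (fundamentalLatticeRep N) (wilsonAction_polyDeriv_suN N)
    (exists_feasible_suN N β n) hP (fun φ hφ => h _ ⟨φ, hφ, rfl⟩) hc

/-- ★★ **The level-`n` feasible values form a compact interval containing the Wilson value.**
[folklore] -/
theorem levelValues_eq_Icc_suN {n : ℕ}
    {P : C(GaugeConfig d L (Matrix.specialUnitaryGroup (Fin N) ℂ), ℝ)}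
    (hP : P ∈ certDomainSuN (d := d) (L := L) N β n) :
    ∃ lo hi : ℝ, levelValuesSuN (d := d) (L := L) N β n P = Set.Icc lo hi ∧
      ∫ U, P U ∂(wilsonMeasure (fundamentalRep (Fin N)) β) ∈ Set.Icc lo hi := by
  obtain ⟨lo, hi, -, h⟩ := exists_feasibleValues_eq_Icc (fundamentalLatticeRep N)
    (wilsonAction_polyDeriv_suN N) (exists_feasible_suN N β n) hP
  refine ⟨lo, hi, h, ?_⟩
  rw [← levelValuesSuN_eq_feasibleValues] at h
  rw [← h]
  exact wilson_mem_levelValues_suN N β n P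

/-- ★★ **No duality gap, as an equation**: the level-`n` SDP upper bound of `P` equals the
infimum of the level-`n` certified upper bounds. [folklore] -/
theorem sSup_levelValues_eq_sInf_suN {n : ℕ}
    {P : C(GaugeConfig d L (Matrix.specialUnitaryGroup (Fin N) ℂ), ℝ)}
    (hP : P ∈ certDomainSuN (d := d) (L := L) N β n) :
    sSup (levelValuesSuN (d := d) (L := L) N β n P) =
      sInf {c : ℝ | c • (1 : C(GaugeConfig d L (Matrix.specialUnitaryGroup (Fin N) ℂ), ℝ)) - P ∈
        certConeSuN (d := d) (L := L) N β n} :=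
  sSup_feasibleValues_eq_sInf (fundamentalLatticeRep N) (wilsonAction_polyDeriv_suN N)
    (exists_feasible_suN N β n) hP

/-! ### Completeness for the Wilson measure -/

/-- ★★★ **Every strict upper bound on a Wilson expectation has an SOS ⊕ loop-equation
certificate.** `SU(N)` on `(ℤ/L)^d`, any real `β`: for every polynomial observable `P` and every
`c > ∫ P dμ_β` there are a level `n`, a non-negative combination `σ` of squares of test functions
of word length `≤ n` and a combination `ρ` of level-`n` row elements with `c • 1 - P = σ + ρ`.
[folklore] -/
theorem exists_certificate_of_wilson_lt_suN
    {P : C(GaugeConfig d L (Matrix.specialUnitaryGroup (Fin N) ℂ), ℝ)}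
    (hP : P ∈ polyAlgebra (ι := Edge d L) (fundamentalLatticeRep N)) {c : ℝ}
    (hc : ∫ U, P U ∂(wilsonMeasure (fundamentalRep (Fin N)) β) < c) :
    ∃ n : ℕ, ∃ σ ∈ sosCone (wordTruncation (ι := Edge d L) (fundamentalLatticeRep N) n),
      ∃ ρ ∈ rowSpace (fundamentalLatticeRep N) (suExp N) (fun _ => wilsonAction (fundamentalRep (Fin N)))
        β (wordTruncation (ι := Edge d L) (fundamentalLatticeRep N) n),
        σ + ρ = c • (1 : C(GaugeConfig d L (Matrix.specialUnitaryGroup (Fin N) ℂ), ℝ)) - P := by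
  set W := ∫ U, P U ∂(wilsonMeasure (d := d) (L := L) (fundamentalRep (Fin N)) β) with hW
  have hε : 0 < (c - W) / 2 := by linarith
  obtain ⟨n, hn, hPn⟩ := ((levelValues_subset_Icc_suN N β hP hε).and
    (eventually_mem_wordTruncation (fundamentalLatticeRep N) hP)).exists
  refine ⟨n, exists_certificate_suN N β (mem_certDomainSuN_of_mem_wordTruncation N β
    (Nat.le_add_right n n) hPn) (c := W + (c - W) / 2) (fun t ht => (hn ht).2) (by linarith)⟩

/-- ★★★ **The same, fully unpacked**: `c • 1 - P = Σ_{v ∈ l} v v + ρ` with `l` a finite list of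
test functions of word length `≤ n` and `ρ` a combination of level-`n` row elements. [folklore] -/
theorem exists_list_certificate_of_wilson_lt_suN
    {P : C(GaugeConfig d L (Matrix.specialUnitaryGroup (Fin N) ℂ), ℝ)}
    (hP : P ∈ polyAlgebra (ι := Edge d L) (fundamentalLatticeRep N)) {c : ℝ}
    (hc : ∫ U, P U ∂(wilsonMeasure (fundamentalRep (Fin N)) β) < c) :
    ∃ n : ℕ, ∃ l : List C(GaugeConfig d L (Matrix.specialUnitaryGroup (Fin N) ℂ), ℝ),
      (∀ v ∈ l, v ∈ wordTruncation (ι := Edge d L) (fundamentalLatticeRep N) n) ∧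
      ∃ ρ ∈ rowSpace (fundamentalLatticeRep N) (suExp N) (fun _ => wilsonAction (fundamentalRep (Fin N)))
        β (wordTruncation (ι := Edge d L) (fundamentalLatticeRep N) n),
        (l.map fun v => v * v).sum + ρ =
          c • (1 : C(GaugeConfig d L (Matrix.specialUnitaryGroup (Fin N) ℂ), ℝ)) - P := by
  obtain ⟨n, σ, hσ, ρ, hρ, h⟩ := exists_certificate_of_wilson_lt_suN N β hP hc
  obtain ⟨l, hl, rfl⟩ := exists_list_of_mem_sosCone
    (fun c v hv => smul_mem_wordTruncation (fundamentalLatticeRep N) c hv) hσ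
  exact ⟨n, l, hl, ρ, hρ, h⟩

/-- ★★★ **Every strict lower bound on a Wilson expectation has a certificate** `P - c • 1 = σ + ρ`
at some level. [folklore] -/
theorem exists_certificate_of_lt_wilson_suN
    {P : C(GaugeConfig d L (Matrix.specialUnitaryGroup (Fin N) ℂ), ℝ)}
    (hP : P ∈ polyAlgebra (ι := Edge d L) (fundamentalLatticeRep N)) {c : ℝ}
    (hc : c < ∫ U, P U ∂(wilsonMeasure (fundamentalRep (Fin N)) β)) :
    ∃ n : ℕ, ∃ σ ∈ sosCone (wordTruncation (ι := Edge d L) (fundamentalLatticeRep N) n),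
      ∃ ρ ∈ rowSpace (fundamentalLatticeRep N) (suExp N) (fun _ => wilsonAction (fundamentalRep (Fin N)))
        β (wordTruncation (ι := Edge d L) (fundamentalLatticeRep N) n),
        σ + ρ = P - c • (1 : C(GaugeConfig d L (Matrix.specialUnitaryGroup (Fin N) ℂ), ℝ)) := by
  set W := ∫ U, P U ∂(wilsonMeasure (d := d) (L := L) (fundamentalRep (Fin N)) β) with hW
  have hε : 0 < (W - c) / 2 := by linarith
  obtain ⟨n, hn, hPn⟩ := ((levelValues_subset_Icc_suN N β hP hε).and
    (eventually_mem_wordTruncation (fundamentalLatticeRep N) hP)).exists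
  refine ⟨n, exists_lower_certificate_suN N β (mem_certDomainSuN_of_mem_wordTruncation N β
    (Nat.le_add_right n n) hPn) (c := W - (W - c) / 2) (fun t ht => (hn ht).1) (by linarith)⟩

/-- ★★★ **Two-sided**: every open window `a < ∫ P dμ_β < b` around a Wilson expectation is
certified from both sides at one common level. [folklore] -/
theorem exists_certificates_of_wilson_mem_Ioo_suN
    {P : C(GaugeConfig d L (Matrix.specialUnitaryGroup (Fin N) ℂ), ℝ)}
    (hP : P ∈ polyAlgebra (ι := Edge d L) (fundamentalLatticeRep N)) {a b : ℝ}
    (ha : a < ∫ U, P U ∂(wilsonMeasure (fundamentalRep (Fin N)) β))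
    (hb : ∫ U, P U ∂(wilsonMeasure (fundamentalRep (Fin N)) β) < b) :
    ∃ n : ℕ, P - a • (1 : C(GaugeConfig d L (Matrix.specialUnitaryGroup (Fin N) ℂ), ℝ)) ∈
        certConeSuN (d := d) (L := L) N β n ∧
      b • (1 : C(GaugeConfig d L (Matrix.specialUnitaryGroup (Fin N) ℂ), ℝ)) - P ∈
        certConeSuN (d := d) (L := L) N β n := by
  set W := ∫ U, P U ∂(wilsonMeasure (d := d) (L := L) (fundamentalRep (Fin N)) β) with hW
  have hε : 0 < min ((W - a) / 2) ((b - W) / 2) := lt_min (by linarith) (by linarith)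
  obtain ⟨n, hn, hPn⟩ := ((levelValues_subset_Icc_suN N β hP hε).and
    (eventually_mem_wordTruncation (fundamentalLatticeRep N) hP)).exists
  have hPd := mem_certDomainSuN_of_mem_wordTruncation N β (Nat.le_add_right n n) hPn
  have h1 := min_le_left ((W - a) / 2) ((b - W) / 2)
  have h2 := min_le_right ((W - a) / 2) ((b - W) / 2)
  refine ⟨n, ?_, ?_⟩
  · obtain ⟨σ, hσ, ρ, hρ, h⟩ := exists_lower_certificate_suN N β hPd
      (c := W - min ((W - a) / 2) ((b - W) / 2)) (c' := a) (fun t ht => (hn ht).1) (by linarith)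
    rw [← h]
    exact (mem_certCone_iff _).2 ⟨σ, hσ, ρ, hρ, rfl⟩
  · obtain ⟨σ, hσ, ρ, hρ, h⟩ := exists_certificate_suN N β hPd
      (c := W + min ((W - a) / 2) ((b - W) / 2)) (c' := b) (fun t ht => (hn ht).2) (by linarith)
    rw [← h]
    exact (mem_certCone_iff _).2 ⟨σ, hσ, ρ, hρ, rfl⟩

end SuN

/-! ## `U(N)` -/

section UN

variable {d L : ℕ} [NeZero L] (N : ℕ) (β : ℝ)

/-- **The level-`n` certificate cone of the `U(N)` torus bootstrap** (shifts `e^{tX}`, `X ∈ 𝔲(N)`;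
`N = 1` is the abelian bootstrap). [folklore] -/
abbrev certConeUN (n : ℕ) : PointedCone ℝ C(GaugeConfig d L (Matrix.unitaryGroup (Fin N) ℂ), ℝ) :=
  certCone (unitaryFundamentalLatticeRep N) (uExp N)
    (fun _ => wilsonAction (unitaryFundamentalRep (Fin N) ℂ)) β
    (wordTruncation (ι := Edge d L) (unitaryFundamentalLatticeRep N) n)

/-- **The level-`n` certificate domain**, `U(N)`. [folklore] -/
abbrev certDomainUN (n : ℕ) : Submodule ℝ C(GaugeConfig d L (Matrix.unitaryGroup (Fin N) ℂ), ℝ) :=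
  certDomain (unitaryFundamentalLatticeRep N) (uExp N)
    (fun _ => wilsonAction (unitaryFundamentalRep (Fin N) ℂ)) β n

/-- The `U(N)` Wilson action has polynomial derivatives along the `𝔲(N)` shifts. -/
theorem wilsonAction_polyDeriv_uN (i : Edge d L) (a : UGenerator N) :
    ∃ S' ∈ polyAlgebra (ι := Edge d L) (unitaryFundamentalLatticeRep N),
      ∀ U : GaugeConfig d L (Matrix.unitaryGroup (Fin N) ℂ),
        HasDerivAt (fun t => wilsonAction (unitaryFundamentalRep (Fin N) ℂ)
          (Function.update U i (uExp N a t * U i))) (S' U) 0 :=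
  exists_polyDeriv_of_mem_polyFunctions (unitaryFundamentalLatticeRep N) (S := fun _ => wilsonAction
    (unitaryFundamentalRep (Fin N) ℂ)) (uExp_add N) (X := fun X : UGenerator N =>
    (X : Matrix (Fin N) (Fin N) ℂ)) (rho_uExp N)
    (fun _ => wilsonAction_mem_polyFunctions (unitaryFundamentalLatticeRep N)) i a

/-- The `U(N)` Wilson functional is level-`n` feasible. -/
theorem exists_feasible_uN (n : ℕ) :
    ∃ φ₀ : C(GaugeConfig d L (Matrix.unitaryGroup (Fin N) ℂ), ℝ) →ₗ[ℝ] ℝ,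
      IsBootstrapFeasible (unitaryFundamentalLatticeRep N) (uExp N)
        (fun _ => wilsonAction (unitaryFundamentalRep (Fin N) ℂ)) β
        (wordTruncation (ι := Edge d L) (unitaryFundamentalLatticeRep N) n) φ₀ := by
  haveI : IsProbabilityMeasure (wilsonMeasure (d := d) (L := L) (unitaryFundamentalRep (Fin N) ℂ) β) :=
    isProbabilityMeasure_wilsonMeasure (ρ := unitaryFundamentalRep (Fin N) ℂ)
      (continuous_unitaryFundamentalRep (n := Fin N) (𝕜 := ℂ)) β
  exact ⟨_, isBootstrapFeasible_wilson_uN N β _ rfl (wordTruncation_subset_polyAlgebra _ n)⟩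

/-- ★★ **Soundness for the `U(N)` Wilson measure.** [folklore] -/
theorem wilson_le_of_mem_certCone_uN {n : ℕ}
    {P : C(GaugeConfig d L (Matrix.unitaryGroup (Fin N) ℂ), ℝ)} {c : ℝ}
    (hc : c • (1 : C(GaugeConfig d L (Matrix.unitaryGroup (Fin N) ℂ), ℝ)) - P ∈
      certConeUN (d := d) (L := L) N β n) :
    ∫ U, P U ∂(wilsonMeasure (unitaryFundamentalRep (Fin N) ℂ) β) ≤ c := by
  obtain ⟨φ, hφ, h⟩ := wilson_mem_levelValues_uN (d := d) (L := L) N β n P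
  rw [← h]
  exact hφ.apply_le_of_mem_certCone _ hc

/-- ★★★ **No duality gap for the `U(N)` torus bootstrap.** [folklore] -/
theorem forall_levelValues_le_iff_uN {n : ℕ}
    {P : C(GaugeConfig d L (Matrix.unitaryGroup (Fin N) ℂ), ℝ)}
    (hP : P ∈ certDomainUN (d := d) (L := L) N β n) {c : ℝ} :
    (∀ t ∈ levelValuesUN (d := d) (L := L) N β n P, t ≤ c) ↔
      ∀ ε : ℝ, 0 < ε → (c + ε) • (1 : C(GaugeConfig d L (Matrix.unitaryGroup (Fin N) ℂ), ℝ))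
        - P ∈ certConeUN (d := d) (L := L) N β n := by
  rw [← forall_feasible_apply_le_iff (unitaryFundamentalLatticeRep N) (wilsonAction_polyDeriv_uN N)
    (exists_feasible_uN N β n) hP]
  exact ⟨fun h φ hφ => h _ ⟨φ, hφ, rfl⟩, fun h t ⟨φ, hφ, ht⟩ => ht ▸ h φ hφ⟩

/-- ★★★ **`U(N)`: every strict upper bound on a Wilson expectation of a polynomial observable has
an SOS ⊕ loop-equation certificate at some level.** [folklore] -/
theorem exists_certificate_of_wilson_lt_uN
    {P : C(GaugeConfig d L (Matrix.unitaryGroup (Fin N) ℂ), ℝ)}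
    (hP : P ∈ polyAlgebra (ι := Edge d L) (unitaryFundamentalLatticeRep N)) {c : ℝ}
    (hc : ∫ U, P U ∂(wilsonMeasure (unitaryFundamentalRep (Fin N) ℂ) β) < c) :
    ∃ n : ℕ, ∃ σ ∈ sosCone (wordTruncation (ι := Edge d L) (unitaryFundamentalLatticeRep N) n),
      ∃ ρ ∈ rowSpace (unitaryFundamentalLatticeRep N) (uExp N)
        (fun _ => wilsonAction (unitaryFundamentalRep (Fin N) ℂ)) β
        (wordTruncation (ι := Edge d L) (unitaryFundamentalLatticeRep N) n),
        σ + ρ = c • (1 : C(GaugeConfig d L (Matrix.unitaryGroup (Fin N) ℂ), ℝ)) - P := by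
  set W := ∫ U, P U ∂(wilsonMeasure (d := d) (L := L) (unitaryFundamentalRep (Fin N) ℂ) β) with hW
  have hε : 0 < (c - W) / 2 := by linarith
  obtain ⟨n, hn, hPn⟩ := ((levelValues_subset_Icc_uN N β hP hε).and
    (eventually_mem_wordTruncation (unitaryFundamentalLatticeRep N) hP)).exists
  have hPd : P ∈ certDomainUN (d := d) (L := L) N β n :=
    mem_certDomain_of_mem_wordTruncation _ (wordTruncation_mono _ (Nat.le_add_right n n) hPn)
  exact ⟨n, exists_certificate_of_forall_apply_le (unitaryFundamentalLatticeRep N)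
    (wilsonAction_polyDeriv_uN N) (exists_feasible_uN N β n) hPd (c := W + (c - W) / 2)
    (fun φ hφ => (hn ⟨φ, hφ, rfl⟩).2) (by linarith)⟩

end UN

end Summit.QuantumFields.GaugeBoot

end
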